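import Mathlib
import HarnessLib
import Literature.Combinatorics.Additive.Pollard
import Literature.Combinatorics.Additive.Kneser
import Literature.Combinatorics.Additive.GrynkiewiczPollardRep
import Literature.Combinatorics.Additive.GrynkiewiczPollardKneserTools
import Literature.Combinatorics.Additive.GrynkiewiczPollardStepOne
import Literature.Combinatorics.Additive.GrynkiewiczPollardStepTwo
import Literature.Combinatorics.Additive.GrynkiewiczPollardDyson
import Literature.Combinatorics.Additive.GrynkiewiczPollardStepFourA
import Literature.Combinatorics.Additive.GrynkiewiczPollardExtension
import Literature.Combinatorics.Additive.GrynkiewiczPollardExtensionProof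
import Literature.Combinatorics.Additive.PollardFourThirdsDysonPair
import Literature.Combinatorics.Additive.PollardFourThirdsSmallTranslates

/-!
# Pollard's theorem in general abelian groups with the constant `−(4/3)t²` (Grynkiewicz–Wang 2026) — III: Theorem 1.8

Topic: `Literature/Combinatorics/Additive`.  Final file of the port of

* D. J. Grynkiewicz, R. Wang, *Pollard's theorem in general abelian groups*, arXiv:2601.17922 (2026).

**Theorem 1.8** (verbatim, p. 4 of the arXiv text): «Let `t ≥ 2` be a positive integer, let `G` be an abelian
group, and let `A, B ⊆ G` be finite subsets with `|A|, |B| ≥ t`.  If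
`Σ_{i=1}^t |A +_i B| < t|A| + t|B| + ⌈−(4/3)t² + (2/3)t⌉`, then there exist subsets `A′ ⊆ A` and `B′ ⊆ B` such
that `|A ∖ A′| + |B ∖ B′| ≤ t − 1` and `A′ +_t B′ = A′ + B′ = A +_t B`.  Moreover, `|A′|, |B′| ≥ t + 1`,
`|A′ + B′| < |A′| + |B′| − t`, and
`Σ_{i=1}^t |A +_i B| ≥ t|A| + t|B| − t² − (t − ℓ)(|H| − ρ − t) ≥ t|A| + t|B| − t|H|`, where `H = H(A +_t B)`,
`ℓ = |A ∖ A′| + |B ∖ B′|`, and `ρ = |(A′ + H) ∖ A′| + |(B′ + H) ∖ B′|`.»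

Here `Σ_{i=1}^t |A +_i B| = Σ_{x ∈ A+B} min(t, r_{A,B}(x))` (the tree's `Grynkiewicz.NS t A B`), and
`⌈−(4/3)t² + (2/3)t⌉ = −⌊(4t² − 2t)/3⌋`; so the hypothesis fails exactly when
`t|A| + t|B| ≤ N_t(A,B) + ⌊(4t² − 2t)/3⌋`, and the theorem is the dichotomy `Grynkiewicz.Goal t ⌊(4t²−2t)/3⌋ A B`
of the tree's port of [Gry10] (where the constant was `2t² − 1`, resp. `4` for `t = 2`).

Proof (§2 of the source): induction on `t` (base `t = 2` = [Gry10] Thm 1.2, tree `Grynkiewicz.goal_all` with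
`c = 4`), and for `t ≥ 3` the triple induction of [Gry10] on `(N_t, −(|A|+|B|), min(|A|,|B|))`
(`Grynkiewicz.meas`), whose step is: the base case `|B| = t`; «Claim 1» (`claim_one`: the theorem for `t − 1`
gives `(t−1)(|A|+|B|) ≤ N_{t−1} + c_{t−1}` or directly the structure for `t`); `|stab A| ≥ t`
(`Grynkiewicz.goal_of_card_addStab_ge`); the maximal translate (`Grynkiewicz.exists_max_translate`); then either
the Dyson pair (`GrynkiewiczWang.dyson_pair`, file I) or small translates (`GrynkiewiczWang.small_translates`,
file II).  The constants: `c_t = ⌊(4t² − 2t)/3⌋` satisfies `t² ≤ c_t`, `3c_t ≥ 4t² − 2t − 2` and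
`3c_{t−1} ≤ 4(t−1)² − 2(t−1)` (`const_bounds`).

Statements: `goal_all` (the dichotomy for every `t ≥ 2`), `grynkiewiczWang2026_thm_1_8` (the printed clauses:
(7) `ℓ ≤ t − 1`, (8) as the two filter identities, `H` nontrivial, the «Moreover» sizes
`|A′|, |B′| ≥ t + 1`, `|A′ + B′| + t + 1 ≤ |A′| + |B′|`, and the stabilizer bound over `ℤ`), and the consumer
form `grynkiewiczWang2026_thm_1_8_weak` in the exact shape of `grynkiewicz2010_thm_1_1_weak` (the form the
cell mm-stpp's rule U11-G consumes: the floor `t|A| + t|B| − ⌊(4t²−2t)/3⌋ ≤ N_t`, or `A′ ⊆ A`, `B′ ⊆ B` with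
`ℓ + 1 ≤ t` and every element of `A′ + B′` `t`-popular in `A + B`).  WHAT THIS IS NOT: not the conjectured
Kneser–Pollard theorem with `−t²` (Conjecture 2.2 of the source, open); the bound is printed-optimal only for
`t ≤ 4`.

## References
* D. J. Grynkiewicz, R. Wang, arXiv:2601.17922 (2026), Theorem 1.8, Proposition 2.1, §2
  [cite: GrynkiewiczWang2026, Thm 1.8].
* D. J. Grynkiewicz, *On extending Pollard's theorem for t-representable sums*, Israel J. Math. 177 (2010)
  413–439, Theorems 1.1 / 1.2 [cite: Grynkiewicz2010, Thm 1.1].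
-/

namespace Literature.Combinatorics.Additive

namespace GrynkiewiczWang

open Finset Pollard Grynkiewicz
open scoped Pointwise

variable {G : Type*} [AddCommGroup G] [DecidableEq G]

/-! ### The constants -/

/-- The constants `c_t = ⌊(4t² − 2t)/3⌋`: `t² ≤ c_t`, `3c_t + 2t + 2 ≥ 4t²`, and
`3c_{t−1} + 10t ≤ 4t² + 6` (i.e. `3c_{t−1} ≤ 4(t−1)² − 2(t−1)`), for `t ≥ 2`.
[cite: GrynkiewiczWang2026, Thm 1.8] -/
theorem const_bounds {t : ℕ} (ht : 2 ≤ t) :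
    t * t ≤ (4 * t * t - 2 * t) / 3 ∧ 4 * t * t ≤ 3 * ((4 * t * t - 2 * t) / 3) + 2 * t + 2 ∧
      3 * ((4 * (t - 1) * (t - 1) - 2 * (t - 1)) / 3) + 10 * t ≤ 4 * t * t + 6 := by
  obtain ⟨s, rfl⟩ : ∃ s, t = s + 2 := ⟨t - 2, by omega⟩
  have e1 : 4 * (s + 2) * (s + 2) = 4 * (s * s) + 16 * s + 16 := by ring
  have e2 : (s + 2) * (s + 2) = s * s + 4 * s + 4 := by ring
  have e3 : s + 2 - 1 = s + 1 := by omega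
  have e4 : 4 * (s + 1) * (s + 1) = 4 * (s * s) + 8 * s + 4 := by ring
  rw [e3, e4, e1, e2]
  have hs : s ≤ s * s := by nlinarith
  omega

/-! ### Claim 1: the theorem for `t − 1` -/

section ClaimOne

variable {t c c' : ℕ} {A B : Finset G}

/-- **«Claim 1» of [GrynkiewiczWang2026] §2.**  From the dichotomy at level `t − 1` for the pair `(A,B)`
(with `|A|, |B| ≥ t ≥ 2` and `(t−1)² ≤ c′`): either `(t−1)(|A|+|B|) ≤ N_{t−1}(A,B) + c′`, or the structural
alternative already holds at level `t` — after STEP 1 at level `t − 1` the structure `(A′, B′)` has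
`|H| − ρ ≥ t`, so every element of `A′ + B′` has at least `t` representations (pigeonhole on coset slices,
`Grynkiewicz.le_rep_add_holes`) and `A′ +_t B′ = A′ + B′ = A +_t B`. [cite: GrynkiewiczWang2026, §2 Claim 1] -/
theorem claim_one (ht : 2 ≤ t) (hc' : (t - 1) * (t - 1) ≤ c') (hA : t ≤ A.card) (hB : t ≤ B.card)
    (h : Goal (t - 1) c' A B) :
    Goal t c A B ∨ (t - 1) * (A.card + B.card) ≤ NS (t - 1) A B + c' := by
  rcases h with hP | ⟨A', B', hS⟩
  · exact Or.inr hP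
  obtain ⟨hA'ne, hB'ne⟩ := hS.nonempty (by omega) (by omega)
  obtain ⟨A'', B'', hS2, hsum, hsubA, hsubB, hsA, hsB⟩ := hS.saturate hA'ne hB'ne
  rw [← hsum] at hsA hsB
  have hA''ne : A''.Nonempty := hA'ne.mono hsubA
  have hB''ne : B''.Nonempty := hB'ne.mono hsubB
  rcases step_one hS2 hA''ne hB''ne hsA hsB with h1 | ⟨-, hHρ, -⟩
  · right; exact le_trans h1 (Nat.add_le_add_left hc' _)
  left; right
  refine ⟨A'', B'', hS2.1, hS2.2.1, by have := hS2.2.2.1; omega, fun w hw => ?_, fun w hw => ?_⟩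
  · obtain ⟨a, ha, b, hb, rfl⟩ := mem_add.1 hw
    have := le_rep_add_holes ha hb
    omega
  · exact hS2.2.2.2.2 w (le_trans (Nat.sub_le t 1) hw)

end ClaimOne

/-! ### The induction step for `t ≥ 3` -/

section Step

variable {t c c' : ℕ} {A B : Finset G}

/-- «Claim 1» is invariant under translating `B`. [cite: GrynkiewiczWang2026, §2] -/
theorem claim_one_vadd (x : G) (h : (t - 1) * (A.card + B.card) ≤ NS (t - 1) A B + c') :
    (t - 1) * (A.card + (x +ᵥ B).card) ≤ NS (t - 1) A (x +ᵥ B) + c' := by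
  rwa [card_vadd_finset, NS_vadd_right]

/-- **The induction step of [GrynkiewiczWang2026] §2 for `t ≥ 3` and `|B| ≤ |A|`.**  Given the theorem at
level `t − 1` (for all pairs) and the induction hypothesis below `(A,B)` at level `t`: `Goal t c A B`, for
constants with `t² ≤ c`, `3c ≥ 4t² − 2t − 2`, `(t−1)² ≤ c′`, `3c′ ≤ 4(t−1)² − 2(t−1)`.
[cite: GrynkiewiczWang2026, Thm 1.8] -/
theorem step_of_le (ht : 3 ≤ t) (hc : t * t ≤ c) (hc3 : 4 * t * t ≤ 3 * c + 2 * t + 2)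
    (hc'1 : (t - 1) * (t - 1) ≤ c') (hc' : 3 * c' + 10 * t ≤ 4 * t * t + 6)
    (ihT : ∀ A₁ B₁ : Finset G, t - 1 ≤ A₁.card → t - 1 ≤ B₁.card → Goal (t - 1) c' A₁ B₁)
    (ih : IH t c A B) (hA : t ≤ A.card) (hB : t ≤ B.card) (hBA : B.card ≤ A.card) : Goal t c A B := by
  -- base case `|B| = t`
  by_cases hBt : B.card ≤ t
  · left
    rw [NS_eq_card_mul_card A hBt]
    have : B.card = t := le_antisymm hBt hB
    rw [this]; nlinarith
  have hB1 : t + 1 ≤ B.card := by omega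
  have hA1 : t + 1 ≤ A.card := by omega
  have hAne : A.Nonempty := card_pos.1 (by omega)
  have hBne : B.Nonempty := card_pos.1 (by omega)
  -- Claim 1
  rcases claim_one (c := c) (by omega) hc'1 hA hB (ihT A B (by omega) (by omega)) with hG | h1
  · exact hG
  -- (stab-A-small)
  by_cases hstab : t ≤ A.addStab.card
  · exact goal_of_card_addStab_ge (by omega) hc ih hA1 hB1 hstab
  rw [not_le] at hstab
  -- the maximal translate
  obtain ⟨x, hx1, hx2, hmax⟩ := exists_max_translate hAne hBne (by omega)
  by_cases hm : t ≤ (A ∩ (x +ᵥ B)).card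
  · -- the Dyson pair for `(A, x + B)`
    refine Goal.of_vadd_right (x := x) (dyson_pair ht hc hc3 hc' (ih.vadd x)
      (by rw [card_vadd_finset]; exact hBA) (by rw [card_vadd_finset]; exact hB1) hm
      (by rw [card_vadd_finset]; exact hx2) (fun z => ?_) (claim_one_vadd x h1))
    rw [vadd_vadd]
    exact hmax (z + x)
  · -- small translates
    rw [not_le] at hm
    exact small_translates ht hc hc3 hc' ih hBA hB1 (fun z => (hmax z).imp (fun h => by omega) id) h1

/-- **The induction step for `t ≥ 3`.** [cite: GrynkiewiczWang2026, Thm 1.8] -/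
theorem step (ht : 3 ≤ t) (hc : t * t ≤ c) (hc3 : 4 * t * t ≤ 3 * c + 2 * t + 2)
    (hc'1 : (t - 1) * (t - 1) ≤ c') (hc' : 3 * c' + 10 * t ≤ 4 * t * t + 6)
    (ihT : ∀ A₁ B₁ : Finset G, t - 1 ≤ A₁.card → t - 1 ≤ B₁.card → Goal (t - 1) c' A₁ B₁)
    (ih : IH t c A B) (hA : t ≤ A.card) (hB : t ≤ B.card) : Goal t c A B := by
  rcases le_total B.card A.card with hBA | hAB
  · exact step_of_le ht hc hc3 hc'1 hc' ihT ih hA hB hBA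
  · exact (step_of_le ht hc hc3 hc'1 hc' ihT ih.symm hB hA hAB).symm

/-- The level-`t` dichotomy from the level-`(t−1)` theorem, by the triple induction on `Grynkiewicz.meas`.
[cite: GrynkiewiczWang2026, Thm 1.8] -/
theorem goal_of_pred (ht : 3 ≤ t) (hc : t * t ≤ c) (hc3 : 4 * t * t ≤ 3 * c + 2 * t + 2)
    (hc'1 : (t - 1) * (t - 1) ≤ c') (hc' : 3 * c' + 10 * t ≤ 4 * t * t + 6)
    (ihT : ∀ A₁ B₁ : Finset G, t - 1 ≤ A₁.card → t - 1 ≤ B₁.card → Goal (t - 1) c' A₁ B₁)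
    (A B : Finset G) (hA : t ≤ A.card) (hB : t ≤ B.card) : Goal t c A B := by
  generalize hμ : meas t A B = μ
  induction μ using WellFoundedLT.induction generalizing A B with
  | _ μ IHμ =>
    subst hμ
    exact step ht hc hc3 hc'1 hc' ihT (fun A₁ B₁ hlt h1 h2 => IHμ _ hlt A₁ B₁ h1 h2 rfl) hA hB

end Step

/-! ### Theorem 1.8 -/

section Main

/-- **[GrynkiewiczWang2026] Theorem 1.8 in dichotomy form:** for every `t ≥ 2` and every pair of finite
sets with `|A|, |B| ≥ t` in an abelian group, `t(|A| + |B|) ≤ N_t(A,B) + ⌊(4t² − 2t)/3⌋` or the structural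
alternative `Grynkiewicz.Str t A B A′ B′` holds for some `A′, B′`.  (Induction on `t`; the base `t = 2` is
[Gry10] Thm 1.2, `Grynkiewicz.goal_all` with `c = 4 = ⌊12/3⌋`.) [cite: GrynkiewiczWang2026, Thm 1.8] -/
theorem goal_all {t : ℕ} (ht : 2 ≤ t) (A B : Finset G) (hA : t ≤ A.card) (hB : t ≤ B.card) :
    Goal t ((4 * t * t - 2 * t) / 3) A B := by
  induction t, ht using Nat.le_induction generalizing A B with
  | base =>
    exact Grynkiewicz.goal_all (t := 2) (c := (4 * 2 * 2 - 2 * 2) / 3) le_rfl (by norm_num) (by norm_num)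
      (Or.inl rfl) A B hA hB
  | succ s hs IHs =>
    obtain ⟨h1, h2, h3⟩ := const_bounds (t := s + 1) (by omega)
    obtain ⟨h1', -, -⟩ := const_bounds (t := s) hs
    have e : s + 1 - 1 = s := by omega
    refine goal_of_pred (c' := (4 * s * s - 2 * s) / 3) (by omega) h1 h2 (by rw [e]; exact h1')
      (by rw [e] at h3; exact h3) (fun A₁ B₁ h1 h2 => ?_) A B hA hB
    rw [e] at h1 h2 ⊢
    exact IHs A₁ B₁ h1 h2

variable {t : ℕ} {A B : Finset G}

/-- The printed clauses from the structural alternative, with the «Moreover» sizes of Theorem 1.8: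
(7) `ℓ ≤ t − 1`, (8) `A′ +_t B′ = A′ + B′ = A +_t B` (two filter identities), `H = stab(A +_t B)` nontrivial,
`|A′|, |B′| ≥ t + 1`, `|A′ + B′| + t + 1 ≤ |A′| + |B′|`, and the stabilizer bound
`t|A| + t|B| − (t − ℓ)(|H| − ρ) − tℓ ≤ N_t` (`= t|A|+t|B| − t² − (t−ℓ)(|H|−ρ−t)`) `≥ t|A| + t|B| − t|H|` over `ℤ`
— or else `t|A| + t|B| ≤ N_t + t²` (STEP 1; from the saturated structure: Kneser tightness and
`|H| ≥ ρ + t + 1`). [cite: GrynkiewiczWang2026, Thm 1.8] -/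
theorem printed_of_str (ht : 1 ≤ t) (hA : t ≤ A.card) (hB : t ≤ B.card) {A' B' : Finset G}
    (hS : Str t A B A' B') :
    t * A.card + t * B.card ≤ NS t A B + t * t ∨
    ∃ A'' ⊆ A, ∃ B'' ⊆ B,
      (A \ A'').card + (B \ B'').card + 1 ≤ t ∧
      (A'' + B'').filter (fun x => t ≤ rep A'' B'' x) = A'' + B'' ∧
      A'' + B'' = (A + B).filter (fun x => t ≤ rep A B x) ∧
      1 < ((A + B).filter (fun x => t ≤ rep A B x)).addStab.card ∧
      t + 1 ≤ A''.card ∧ t + 1 ≤ B''.card ∧ (A'' + B'').card + t + 1 ≤ A''.card + B''.card ∧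
      (t : ℤ) * A.card + t * B.card -
          (t - ((A \ A'').card + (B \ B'').card : ℕ)) *
            ((((A + B).filter (fun x => t ≤ rep A B x)).addStab.card : ℤ) -
              (((A'' + ((A + B).filter (fun x => t ≤ rep A B x)).addStab).card - A''.card) +
                ((B'' + ((A + B).filter (fun x => t ≤ rep A B x)).addStab).card - B''.card) : ℕ)) -
          t * ((A \ A'').card + (B \ B'').card : ℕ) ≤ (NS t A B : ℤ) ∧
      (t : ℤ) * A.card + t * B.card - t * ((A + B).filter (fun x => t ≤ rep A B x)).addStab.card ≤
        (t : ℤ) * A.card + t * B.card -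
          (t - ((A \ A'').card + (B \ B'').card : ℕ)) *
            ((((A + B).filter (fun x => t ≤ rep A B x)).addStab.card : ℤ) -
              (((A'' + ((A + B).filter (fun x => t ≤ rep A B x)).addStab).card - A''.card) +
                ((B'' + ((A + B).filter (fun x => t ≤ rep A B x)).addStab).card - B''.card) : ℕ)) -
          t * ((A \ A'').card + (B \ B'').card : ℕ) := by
  obtain ⟨hA'ne, hB'ne⟩ := hS.nonempty hA hB
  obtain ⟨A'', B'', hS2, hsum, hsubA, hsubB, hsA, hsB⟩ := hS.saturate hA'ne hB'ne
  rw [← hsum] at hsA hsB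
  have hA''ne : A''.Nonempty := hA'ne.mono hsubA
  have hB''ne : B''.Nonempty := hB'ne.mono hsubB
  rcases step_one hS2 hA''ne hB''ne hsA hsB with h1 | ⟨htight, hHρ, h9⟩
  · left; rw [mul_add] at h1; exact h1
  right
  have hfilt : A'' + B'' = (A + B).filter (fun x => t ≤ rep A B x) := by
    ext w
    rw [mem_filter]
    exact ⟨fun hw => ⟨hS2.add_subset hw, (hS2.le_rep_iff w).2 hw⟩, fun hw => (hS2.le_rep_iff w).1 hw.2⟩
  refine ⟨A'', hS2.1, B'', hS2.2.1, hS2.2.2.1, filter_true_of_mem hS2.2.2.2.1, hfilt, ?_⟩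
  rw [← hfilt]
  set H := (A'' + B'').addStab with hH
  set l := (A \ A'').card + (B \ B'').card with hl
  have hSne : (A'' + B'').Nonempty := hA''ne.add hB''ne
  have hρA : A''.card ≤ (A'' + H).card := card_le_card_add_addStab hSne A''
  have hρB : B''.card ≤ (B'' + H).card := card_le_card_add_addStab hSne B''
  set ρ := ((A'' + H).card - A''.card) + ((B'' + H).card - B''.card) with hρ
  have hcA := card_sdiff_add_card_eq_card hS2.1
  have hcB := card_sdiff_add_card_eq_card hS2.2.1
  have hlt : l + 1 ≤ t := hS2.2.2.1
  -- the «Moreover» sizes: a coset slice of `A''` has at least `|H| − ρ_{A''} ≥ t + 1` elements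
  obtain ⟨a, ha⟩ := hA''ne
  obtain ⟨b, hb⟩ := hB''ne
  have hcosA := card_addStab_le_card_inter_coset_add_holes hSne ha (A := A'') (S := A'' + B'')
  have hcosB := card_addStab_le_card_inter_coset_add_holes hSne hb (A := B'') (S := A'' + B'')
  rw [← hH] at hcosA hcosB
  have hAcos : (A'' ∩ (a +ᵥ H)).card ≤ A''.card := card_le_card inter_subset_left
  have hBcos : (B'' ∩ (b +ᵥ H)).card ≤ B''.card := card_le_card inter_subset_left
  obtain ⟨d, hd⟩ : ∃ d, H.card = ρ + d := ⟨H.card - ρ, by omega⟩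
  rw [hd, Nat.add_sub_cancel_left] at h9
  have hSd : (A'' + B'').card + d + l = A.card + B.card := by omega
  refine ⟨by omega, by omega, by omega, by omega, ?_, ?_⟩
  · -- (9), first inequality
    have key : (t : ℤ) * A.card + t * B.card - (t - l) * (d : ℤ) - t * l ≤ (NS t A B : ℤ) := by
      have h9' : ((t * (A'' + B'').card + l * d : ℕ) : ℤ) ≤ (NS t A B : ℤ) := by exact_mod_cast h9
      have hSd' : (((A'' + B'').card + d + l : ℕ) : ℤ) = ((A.card + B.card : ℕ) : ℤ) := by
        exact_mod_cast hSd
      push_cast at h9' hSd'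
      nlinarith [h9', hSd']
    have e2 : ((ρ + d : ℕ) : ℤ) - (ρ : ℤ) = d := by push_cast; ring
    rw [hd]
    rw [e2]
    convert key using 2
  · -- (9), second inequality
    rw [hd]
    have e2 : ((ρ + d : ℕ) : ℤ) - (ρ : ℤ) = d := by push_cast; ring
    rw [e2]
    have hdt : (t : ℤ) + 1 ≤ d := by exact_mod_cast (show t + 1 ≤ d by omega)
    have hl0 : (0 : ℤ) ≤ l := by exact_mod_cast Nat.zero_le l
    have hlt' : (l : ℤ) ≤ t := by exact_mod_cast (show l ≤ t by omega)
    have hρ0 : (0 : ℤ) ≤ ρ := by exact_mod_cast Nat.zero_le ρ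
    push_cast [show l ≤ t by omega]
    nlinarith [mul_nonneg hl0 (sub_nonneg.2 hdt), hρ0, hlt']

/-- **[GrynkiewiczWang2026] Theorem 1.8** (as printed, cf. the module docstring), in the shape of the tree's
`grynkiewicz2010_thm_1_1`: for `G` abelian, `t ≥ 2`, finite `A, B ⊆ G` with `|A|, |B| ≥ t`, either
`t|A| + t|B| ≤ Σ_{x ∈ A+B} min(t, r_{A,B}(x)) + ⌊(4t² − 2t)/3⌋` (the negation of the printed hypothesis
`Σ < t|A| + t|B| + ⌈−(4/3)t² + (2/3)t⌉`), or there are `A′ ⊆ A`, `B′ ⊆ B` with `ℓ = |A ∖ A′| + |B ∖ B′| ≤ t − 1`,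
`A′ +_t B′ = A′ + B′` and `A′ + B′ = A +_t B` (filter identities), `H = stab(A +_t B)` nontrivial,
`|A′|, |B′| ≥ t + 1`, `|A′ + B′| < |A′| + |B′| − t`, and
`t|A| + t|B| − (t − ℓ)(|H| − ρ) − tℓ ≤ Σ` with `t|A| + t|B| − t|H| ≤ t|A| + t|B| − (t − ℓ)(|H| − ρ) − tℓ` (over `ℤ`;
`ρ = |A′ + H| − |A′| + |B′ + H| − |B′|`). [cite: GrynkiewiczWang2026, Thm 1.8] -/
theorem grynkiewiczWang2026_thm_1_8 :
    ∀ (G : Type) [AddCommGroup G] [DecidableEq G] (A B : Finset G) (t : ℕ), 2 ≤ t →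
      t ≤ A.card → t ≤ B.card →
      t * A.card + t * B.card ≤ (∑ x ∈ A + B, min t (Pollard.rep A B x)) + (4 * t * t - 2 * t) / 3 ∨
      ∃ A' ⊆ A, ∃ B' ⊆ B,
        let S : Finset G := (A + B).filter (fun x => t ≤ Pollard.rep A B x)
        let H : Finset G := S.addStab
        let l : ℕ := (A \ A').card + (B \ B').card
        let ρ : ℕ := ((A' + H).card - A'.card) + ((B' + H).card - B'.card)
        l + 1 ≤ t ∧
        (A' + B').filter (fun x => t ≤ Pollard.rep A' B' x) = A' + B' ∧ A' + B' = S ∧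
        1 < H.card ∧
        t + 1 ≤ A'.card ∧ t + 1 ≤ B'.card ∧ (A' + B').card + t + 1 ≤ A'.card + B'.card ∧
        (t : ℤ) * A.card + t * B.card - (t - l) * ((H.card : ℤ) - ρ) - t * l ≤
          ((∑ x ∈ A + B, min t (Pollard.rep A B x) : ℕ) : ℤ) ∧
        (t : ℤ) * A.card + t * B.card - t * H.card ≤
          (t : ℤ) * A.card + t * B.card - (t - l) * ((H.card : ℤ) - ρ) - t * l := by
  intro G _ _ A B t ht hA hB
  obtain ⟨hc, -, -⟩ := const_bounds ht
  rcases goal_all ht A B hA hB with hP | ⟨A', B', hS⟩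
  · left
    change t * A.card + t * B.card ≤ NS t A B + (4 * t * t - 2 * t) / 3
    rw [mul_add] at hP; exact hP
  · rcases printed_of_str (by omega) hA hB hS with hP | hrest
    · left
      change t * A.card + t * B.card ≤ NS t A B + (4 * t * t - 2 * t) / 3
      omega
    · right; exact hrest

/-- **Theorem 1.8, weak form** — the shape the cell mm-stpp's rule U11-G consumes (cf.
`grynkiewicz2010_thm_1_1_weak`): for `t ≥ 2` and `|A|, |B| ≥ t`, either
`t|A| + t|B| ≤ Σ_{x ∈ A+B} min(t, r_{A,B}(x)) + ⌊(4t² − 2t)/3⌋`, or there are `A′ ⊆ A`, `B′ ⊆ B` with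
`|A ∖ A′| + |B ∖ B′| + 1 ≤ t` and every element of `A′ + B′` having at least `t` representations in `A + B`.
[cite: GrynkiewiczWang2026, Thm 1.8] -/
theorem grynkiewiczWang2026_thm_1_8_weak :
    ∀ (G : Type) [AddCommGroup G] [DecidableEq G] (A B : Finset G) (t : ℕ), 2 ≤ t →
      t ≤ A.card → t ≤ B.card →
      t * A.card + t * B.card ≤ (∑ x ∈ A + B, min t (Pollard.rep A B x)) + (4 * t * t - 2 * t) / 3 ∨
      ∃ A' ⊆ A, ∃ B' ⊆ B, (A \ A').card + (B \ B').card + 1 ≤ t ∧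
        ∀ x ∈ A' + B', t ≤ Pollard.rep A B x := by
  intro G _ _ A B t ht hA hB
  rcases goal_all ht A B hA hB with hP | ⟨A', B', hS⟩
  · left
    change t * A.card + t * B.card ≤ NS t A B + (4 * t * t - 2 * t) / 3
    rw [mul_add] at hP; exact hP
  · right
    exact ⟨A', hS.1, B', hS.2.1, hS.2.2.1, fun x hx => (hS.le_rep_iff x).2 hx⟩

/-- The constants compared: `⌊(4t² − 2t)/3⌋ + 1 ≤ 2t² − 1` for `t ≥ 3`, i.e. the floor of Theorem 1.8 is
strictly above that of [Gry10] Thm 1.1 (6). [cite: GrynkiewiczWang2026, Thm 1.8] -/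
theorem const_lt_gry10 {t : ℕ} (ht : 3 ≤ t) : (4 * t * t - 2 * t) / 3 + 2 ≤ 2 * t * t := by
  obtain ⟨s, rfl⟩ : ∃ s, t = s + 3 := ⟨t - 3, by omega⟩
  have e1 : 4 * (s + 3) * (s + 3) = 4 * (s * s) + 24 * s + 36 := by ring
  have e2 : 2 * (s + 3) * (s + 3) = 2 * (s * s) + 12 * s + 18 := by ring
  rw [e1, e2]
  omega

end Main

end GrynkiewiczWang

end Literature.Combinatorics.Additive
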